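import Mathlib
import HarnessLib
import Summits.ValiantsHypothesis.ValiantsHypothesis.Theses.MonotoneRestoration
import Literature.Computability.AlgebraicComplexity.ArithCircuit
import Literature.Computability.AlgebraicComplexity.ArithCircuitProofs
import Literature.Computability.AlgebraicComplexity.MonotoneStructure
import Literature.Computability.AlgebraicComplexity.PermanentIrreducible
import Literature.ModelTheory.FiniteModelTheory.CkEquiv
import Summits.ValiantsHypothesis.ValiantsHypothesis.Theorems.MonotoneRestorationMonotoneRestorationQPCosetCount
import Summits.ValiantsHypothesis.ValiantsHypothesis.Theorems.MonotoneRestorationMonotoneRestorationQPSymmetricLB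
import Summits.ValiantsHypothesis.ValiantsHypothesis.Theorems.MonotoneRestorationMonotoneRestorationQPSupportSymmetrisation
import Summits.ValiantsHypothesis.ValiantsHypothesis.Theorems.MonotoneRestorationMonotoneRestorationQPSparseRegime
import Summits.ValiantsHypothesis.ValiantsHypothesis.Theorems.MonotoneRestorationMonotoneRestorationQPBeta
import Literature.Computability.AlgebraicComplexity.SymmetricArithCircuit
import Literature.Computability.AlgebraicComplexity.DawarWilsenach2025Proofs
import Literature.GroupTheory.PermutationGroups.SmallIndexSubgroups
import Summits.ValiantsHypothesis.ValiantsHypothesis.Theorems.MonotoneRestorationQP.Negative.LoadBearing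
import Summits.ValiantsHypothesis.ValiantsHypothesis.Theorems.MonotoneRestorationMonotoneRestorationQPPermSupportCount

/-! TTRL-lite variant V20722 of stmt-ValiantsHypothesis-15886 -/

set_option linter.dupNamespace false

namespace Summit.ValiantsHypothesis.ValiantsHypothesis.Theorems

open Summit.ValiantsHypothesis.ValiantsHypothesis.Theses.MonotoneRestoration
open Literature.Computability.AlgebraicComplexity

/-- Dyadic-block monotonicity of the `γ`-regime side conditions: if `n ≤ n'` lie in the same
dyadic block (`Nat.log 2 n' = Nat.log 2 n`), then the parameter `k = (log₂ n + c)^c + 2` is the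
same for both, and each conjunct (`8 < n`, `4k ≤ n`, `k² ≤ n/2`, `n/2 + k + 9 ≤ n`,
`2^(k-2) < C(n,k)`) is monotone in `n` (`Nat.div_le_div_right`, `Nat.choose_le_choose`), so the
conjunction transfers from `n` to `n'`. -/
theorem stub_gammaArithmetic_var20722 :
    ∀ (c n n' : ℕ), n ≤ n' → Nat.log 2 n' = Nat.log 2 n →
      (8 < n ∧ 4 * ((Nat.log 2 n + c) ^ c + 2) ≤ n ∧
        ((Nat.log 2 n + c) ^ c + 2) * ((Nat.log 2 n + c) ^ c + 2) ≤ n / 2 ∧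
        n / 2 + ((Nat.log 2 n + c) ^ c + 2) + 9 ≤ n ∧
        2 ^ ((Nat.log 2 n + c) ^ c) < n.choose ((Nat.log 2 n + c) ^ c + 2)) →
      (8 < n' ∧ 4 * ((Nat.log 2 n' + c) ^ c + 2) ≤ n' ∧
        ((Nat.log 2 n' + c) ^ c + 2) * ((Nat.log 2 n' + c) ^ c + 2) ≤ n' / 2 ∧
        n' / 2 + ((Nat.log 2 n' + c) ^ c + 2) + 9 ≤ n' ∧
        2 ^ ((Nat.log 2 n' + c) ^ c) < n'.choose ((Nat.log 2 n' + c) ^ c + 2)) := by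
  intro c n n' hle hlog h
  rw [hlog]
  obtain ⟨h1, h2, h3, h4, h5⟩ := h
  generalize (Nat.log 2 n + c) ^ c = m at *
  refine ⟨lt_of_lt_of_le h1 hle, h2.trans hle, h3.trans (Nat.div_le_div_right hle), ?_,
    lt_of_lt_of_le h5 (Nat.choose_le_choose (m + 2) hle)⟩
  omega

end Summit.ValiantsHypothesis.ValiantsHypothesis.Theorems
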